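import Mathlib
import HarnessLib
import Summits.AtomisticToContinuum.FouriersLaw.Theses.JunctionLocality
import Summits.AtomisticToContinuum.FouriersLaw.Theorems.JunctionLocalitySuperadditiveResistanceDeviceLiouville
import Summits.AtomisticToContinuum.FouriersLaw.Theorems.JunctionLocalitySuperadditiveResistanceStubDeviceForwardFieldsAux5
import Summits.AtomisticToContinuum.FouriersLaw.Theorems.JunctionLocalitySuperadditiveResistanceStubDeviceForwardFieldsAux6
import Summits.AtomisticToContinuum.FouriersLaw.Theorems.JunctionLocalitySuperadditiveResistanceStubKuboFrameResolventBound
import Summits.AtomisticToContinuum.FouriersLaw.Theorems.JunctionLocalitySuperadditiveResistanceStubKuboFrameAbelian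
import Summits.AtomisticToContinuum.FouriersLaw.Theorems.JunctionLocalitySuperadditiveResistanceStubBypassBoundAux2
import Summits.AtomisticToContinuum.FouriersLaw.Theorems.JunctionLocalityConductanceLowerBoundRelocForwardFieldAnchors

/-!
# The weak Abelian limit `λ (λ − L)⁻¹ k ⇀ 0` for relocated resolvent families
(helper `relocEnd_meanErgodic` toward stub `stub_kuboLink_resolvent` (ENDλ) of line `cold-bath-relocation-walk`,
crux stmt-AtomisticToContinuum-11749 `JunctionLocality.ConductanceLowerBound`; `--supports` stmt-AtomisticToContinuum-11749)

Setting: ONE `L`-site Hamiltonian `H` of `pinnedChain ω₂ lam β γ`, its Gibbs state `μ_T`, and the equilibrium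
operator `σ X_H + c S_B` (`X_H = liouvilleOp`, `S_B = bathOp L B T`) with site weights `B ≥ 0` charging site `0`,
`σ ≠ 0`, friction `c > 0`.  For `λ > 0` and a source `k ∈ L²(μ_T)` of MEAN ZERO let `v_λ ∈ C² ∩ L²(μ_T)` be ANY
family of classical solutions of the resolvent equation `λ v_λ − (σ X_H v_λ + c S_B v_λ) = k`.

* `resolvent_sq_bound_gibbsMeasure` — the dissipative bound in `μ_T`-form: `λ² ∫ v_λ² dμ_T ≤ ∫ k² dμ_T`
  (landed Lebesgue form `resolvent_sq_bound`).
* `tendsto_resolvent_pairing` — the WEAK ABELIAN LIMIT: `λ ∫ v_λ φ dμ_T → 0` as `λ → 0⁺` for every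
  `φ ∈ L²(μ_T)` (mean ergodic theorem in Abelian form for `σ X_H + c S_B` on `L²(μ_T)`, whose kernel is the
  constants).  Proof without semigroup or compactness (adapted from the landed device version
  `helper_resolventWeakAbelian`): the classes `[λ v_λ]` are bounded in the Hilbert space `L²(μ_T)` by `‖k‖`;
  on constants `λ ∫ v_λ dμ_T = ∫ k dμ_T = 0` (mass identity `integral_resolvent_mul_gibbsDensity`); on the adjoint
  range `ψ = −σ X_H f + c S_B f`, `f ∈ C_c^∞`: `λ⟨v_λ, ψ⟩ = λ²⟨v_λ, f⟩ − λ⟨k, f⟩ → 0`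
  (`integral_adjointOp_mul_resolvent`); DENSITY of `ℝ·1 + (−σ X_H + c S_B)(C_c^∞)` in `L²(μ_T)`
  (`ae_eq_zero_of_orthogonal_adjointRange`: Hörmander regularity + the `L²(μ_T)`-Liouville theorem); then `ε/2`.
* `relocEnd_meanErgodic` — the registered special case used by ENDλ: the BACKWARD operator (`σ = −1`) of the
  plain chain (thermostats on sites `0` and `L − 1`, friction `γ`), source `p_0² − T`.
No definitions; standard axioms.  References: folklore (von Neumann mean ergodic theorem, Abelian form).
-/

noncomputable section

open MeasureTheory Filter Topology
open scoped ContDiff InnerProductSpace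
open Literature.MathematicalPhysics.KineticTheory.HeatConduction
open Summit.AtomisticToContinuum.FouriersLaw.Theorems.SuperadditiveResistance.DeviceLiouville
  (kin thermo liouvilleOp bathOp kin_eq_sq)
open Summit.AtomisticToContinuum.FouriersLaw.Theorems.SuperadditiveResistance.Kubo
  (integrable_mul_gibbsDensity_iff)
open Summit.AtomisticToContinuum.FouriersLaw.Cruxes.SuperadditiveResistance.FloatingProbeBypassLaplacian
  (inner_toLp_left inner_toLp_toLp norm_toLp_sq memLp_two_of_hasCompactSupport continuous_genOp
    hasCompactSupport_genOp pinnedChain_memLp_two_kin pinnedChain_memLp_two_snd pinnedChain_integral_snd_sq)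
open Summit.AtomisticToContinuum.FouriersLaw.Cruxes.SuperadditiveResistance.ThermaliseThenCutProbeInsertion
  (integral_adjointOp_mul_resolvent integral_resolvent_mul_gibbsDensity ae_eq_zero_of_orthogonal_adjointRange
    resolvent_sq_bound)

namespace Summit.AtomisticToContinuum.FouriersLaw.Cruxes.ConductanceLowerBound.ColdBathRelocationWalk

section General

variable {ω₂ lam β γ : ℝ} {L : ℕ}

/-- **Dissipative resolvent bound, `μ_T`-form.**  For a `σ`-resolvent pair `σ X_H g + c S_B g = −(k − κ g)`
(`B ≥ 0`, `c > 0`, `κ > 0`, `g ∈ C² ∩ L²(μ_T)`, `k ∈ L²(μ_T)`): `κ² ∫ g² dμ_T ≤ ∫ k² dμ_T`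
(the landed Lebesgue form `resolvent_sq_bound`, normalised by the partition function). [folklore] -/
theorem resolvent_sq_bound_gibbsMeasure (hω : 0 < ω₂) (hl : 0 ≤ lam) (hβ : 0 ≤ β) (L : ℕ) {T : ℝ}
    (hT : 0 < T) (B : Fin L → ℝ) (hB : ∀ i, 0 ≤ B i) (σ : ℝ) {c : ℝ} (hc : 0 < c) {κ : ℝ} (hκ : 0 < κ)
    {g k : PhaseSpace L → ℝ} (hg : ContDiff ℝ 2 g)
    (hg2 : MemLp g 2 ((pinnedChain ω₂ lam β γ).gibbsMeasure L T))
    (hk2 : MemLp k 2 ((pinnedChain ω₂ lam β γ).gibbsMeasure L T))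
    (hpde : ∀ x, σ * liouvilleOp (pinnedChain ω₂ lam β γ) L g x + c * bathOp L B T g x = -(k x - κ * g x)) :
    κ ^ 2 * ∫ x, g x ^ 2 ∂((pinnedChain ω₂ lam β γ).gibbsMeasure L T) ≤
      ∫ x, k x ^ 2 ∂((pinnedChain ω₂ lam β γ).gibbsMeasure L T) := by
  have hleb := resolvent_sq_bound hω hl hβ L hT B hB σ hc hκ hg hg2 hk2 hpde
  have hZ : 0 < ∫ x, (pinnedChain ω₂ lam β γ).gibbsDensity L T x :=
    integral_exp_pos (pinnedChain_integrable_gibbsDensity hω hl hβ γ L hT)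
  rw [(pinnedChain ω₂ lam β γ).integral_gibbsMeasure, (pinnedChain ω₂ lam β γ).integral_gibbsMeasure,
    show κ ^ 2 * ((∫ x, (pinnedChain ω₂ lam β γ).gibbsDensity L T x)⁻¹ *
        ∫ x, g x ^ 2 * (pinnedChain ω₂ lam β γ).gibbsDensity L T x) =
      (∫ x, (pinnedChain ω₂ lam β γ).gibbsDensity L T x)⁻¹ *
        (κ ^ 2 * ∫ x, g x ^ 2 * (pinnedChain ω₂ lam β γ).gibbsDensity L T x) by ring]
  exact mul_le_mul_of_nonneg_left hleb (inv_nonneg.2 hZ.le)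

/-- **Mean of a resolvent field with a mean-zero source, `μ_T`-form**: if `σ X_H g + c S_B g = −(k − κ g)`
(`B ≥ 0`, `c > 0`, `κ ≠ 0`, `g ∈ C² ∩ L²(μ_T)`, `k ∈ L²(μ_T)`, `∫ k dμ_T = 0`) then `∫ g dμ_T = 0`
(mass identity `κ ∫ g = ∫ k`, landed `integral_resolvent_mul_gibbsDensity`). [folklore] -/
theorem integral_resolvent_eq_zero (hω : 0 < ω₂) (hl : 0 ≤ lam) (hβ : 0 ≤ β) (L : ℕ) {T : ℝ}
    (hT : 0 < T) (B : Fin L → ℝ) (hB : ∀ i, 0 ≤ B i) (σ : ℝ) {c : ℝ} (hc : 0 < c) {κ : ℝ} (hκ : κ ≠ 0)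
    {g k : PhaseSpace L → ℝ} (hg : ContDiff ℝ 2 g)
    (hg2 : MemLp g 2 ((pinnedChain ω₂ lam β γ).gibbsMeasure L T))
    (hk2 : MemLp k 2 ((pinnedChain ω₂ lam β γ).gibbsMeasure L T))
    (hk0 : ∫ x, k x ∂((pinnedChain ω₂ lam β γ).gibbsMeasure L T) = 0)
    (hpde : ∀ x, σ * liouvilleOp (pinnedChain ω₂ lam β γ) L g x + c * bathOp L B T g x = -(k x - κ * g x)) :
    ∫ x, g x ∂((pinnedChain ω₂ lam β γ).gibbsMeasure L T) = 0 := by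
  have hZ : 0 < ∫ x, (pinnedChain ω₂ lam β γ).gibbsDensity L T x :=
    integral_exp_pos (pinnedChain_integrable_gibbsDensity hω hl hβ γ L hT)
  have h := integral_resolvent_mul_gibbsDensity hω hl hβ L hT B hB σ hc κ hg hg2 hk2 hpde
  rw [(pinnedChain ω₂ lam β γ).integral_gibbsMeasure] at hk0
  have hk0' : ∫ x, k x * (pinnedChain ω₂ lam β γ).gibbsDensity L T x = 0 :=
    (mul_eq_zero.1 hk0).resolve_left (inv_ne_zero hZ.ne')
  rw [hk0'] at h
  rw [(pinnedChain ω₂ lam β γ).integral_gibbsMeasure, (mul_eq_zero.1 h).resolve_left hκ, mul_zero]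

/-- **Weak Abelian limit of resolvent families (mean ergodic theorem, Abelian form).**  For `pinnedChain ω₂ lam β γ`
(`ω₂ > 0`, `lam, β ≥ 0`), `L ≥ 1`, `T > 0`, `σ ≠ 0`, `c > 0`, weights `B ≥ 0` with `B_0 > 0`, a mean-zero source
`k ∈ L²(μ_T)` and ANY family `v_κ ∈ C² ∩ L²(μ_T)` (`κ > 0`) of classical solutions of
`κ v_κ − (σ X_H v_κ + c S_B v_κ) = k`: `κ ∫ v_κ φ dμ_T → 0` as `κ → 0⁺` for every `φ ∈ L²(μ_T)`.
(adapted from `helper_resolventWeakAbelian`) [folklore] -/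
theorem tendsto_resolvent_pairing (hω : 0 < ω₂) (hl : 0 ≤ lam) (hβ : 0 ≤ β) (γ : ℝ) (hL : 0 < L)
    {T : ℝ} (hT : 0 < T) {σ c : ℝ} (hσ : σ ≠ 0) (hc : 0 < c) {B : Fin L → ℝ} (hB : ∀ i, 0 ≤ B i)
    (hB0 : 0 < B ⟨0, hL⟩) {k : PhaseSpace L → ℝ} (hk2 : MemLp k 2 ((pinnedChain ω₂ lam β γ).gibbsMeasure L T))
    (hk0 : ∫ x, k x ∂((pinnedChain ω₂ lam β γ).gibbsMeasure L T) = 0) {v : ℝ → PhaseSpace L → ℝ}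
    (hv : ∀ κ : ℝ, 0 < κ → ContDiff ℝ 2 (v κ) ∧ MemLp (v κ) 2 ((pinnedChain ω₂ lam β γ).gibbsMeasure L T) ∧
      ∀ x, κ * v κ x - (σ * liouvilleOp (pinnedChain ω₂ lam β γ) L (v κ) x + c * bathOp L B T (v κ) x) = k x)
    {φ : PhaseSpace L → ℝ} (hφ : MemLp φ 2 ((pinnedChain ω₂ lam β γ).gibbsMeasure L T)) :
    Tendsto (fun κ : ℝ => κ * ∫ x, v κ x * φ x ∂((pinnedChain ω₂ lam β γ).gibbsMeasure L T))
      (𝓝[>] 0) (𝓝 0) := by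
  -- the setting
  set P := pinnedChain ω₂ lam β γ with hP
  haveI : IsProbabilityMeasure (P.gibbsMeasure L T) :=
    pinnedChain_isProbabilityMeasure_gibbsMeasure hω hl hβ γ L hT
  have hU1 : ContDiff ℝ 1 P.U := pinnedChain_contDiff_U ω₂ lam β γ
  have hV1 : ContDiff ℝ 1 P.V := pinnedChain_contDiff_V ω₂ lam β γ
  -- the resolvent family (κ > 0)
  have hC2 : ∀ κ, 0 < κ → ContDiff ℝ 2 (v κ) := fun κ hκ => (hv κ hκ).1
  have hL2 : ∀ κ, 0 < κ → MemLp (v κ) 2 (P.gibbsMeasure L T) := fun κ hκ => (hv κ hκ).2.1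
  have hpair : ∀ κ, 0 < κ → ∀ x, σ * liouvilleOp P L (v κ) x + c * bathOp L B T (v κ) x =
      -(k x - κ * v κ x) := by
    intro κ hκ x
    have e := (hv κ hκ).2.2 x
    linarith
  -- (1) the uniform bound `κ² ‖v_κ‖² ≤ ‖k‖²`
  set K : ℝ := ∫ x, k x ^ 2 ∂(P.gibbsMeasure L T) with hK
  have hbound : ∀ κ, 0 < κ → κ ^ 2 * ∫ x, v κ x ^ 2 ∂(P.gibbsMeasure L T) ≤ K :=
    fun κ hκ => resolvent_sq_bound_gibbsMeasure hω hl hβ L hT B hB σ hc hκ (hC2 κ hκ) (hL2 κ hκ) hk2 (hpair κ hκ)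
  -- (2) the mean: `∫ v_κ dμ_T = 0`
  have hmean : ∀ κ, 0 < κ → ∫ x, v κ x ∂(P.gibbsMeasure L T) = 0 := fun κ hκ =>
    integral_resolvent_eq_zero hω hl hβ L hT B hB σ hc hκ.ne' (hC2 κ hκ) (hL2 κ hκ) hk2 hk0 (hpair κ hκ)
  -- the Hilbert space `L²(μ_T)`, the classes `W κ = [κ v_κ]`, the constant `1`
  have hW : ∀ κ (hκ : 0 < κ) (ψ : PhaseSpace L → ℝ) (hψ : MemLp ψ 2 (P.gibbsMeasure L T)),
      ⟪κ • (hL2 κ hκ).toLp (v κ), hψ.toLp ψ⟫_ℝ = κ * ∫ x, v κ x * ψ x ∂(P.gibbsMeasure L T) := by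
    intro κ hκ ψ hψ
    rw [real_inner_smul_left, inner_toLp_toLp]
  set C₀ : ℝ := Real.sqrt K with hC₀
  have hC₀nn : 0 ≤ C₀ := Real.sqrt_nonneg _
  have hWnorm : ∀ κ (hκ : 0 < κ), ‖κ • (hL2 κ hκ).toLp (v κ)‖ ≤ C₀ := by
    intro κ hκ
    have h1 : ‖κ • (hL2 κ hκ).toLp (v κ)‖ ^ 2 ≤ K := by
      rw [norm_smul, mul_pow, Real.norm_eq_abs, sq_abs, norm_toLp_sq]
      exact hbound κ hκ
    simpa only [abs_of_nonneg (norm_nonneg _)] using Real.abs_le_sqrt h1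
  -- the family as a function on `ℝ` (zero for `κ ≤ 0`)
  set W : ℝ → Lp ℝ 2 (P.gibbsMeasure L T) := fun κ =>
    if h : 0 < κ then κ • (hL2 κ h).toLp (v κ) else 0 with hWdef
  have hWpos : ∀ κ (hκ : 0 < κ), W κ = κ • (hL2 κ hκ).toLp (v κ) := fun κ hκ => by
    simp only [hWdef, dif_pos hκ]
  have hWnorm' : ∀ κ, ‖W κ‖ ≤ C₀ := fun κ => by
    by_cases hκ : 0 < κ
    · rw [hWpos κ hκ]; exact hWnorm κ hκ
    · simp only [hWdef, dif_neg hκ, norm_zero]; exact hC₀nn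
  have hev : ∀ᶠ κ in 𝓝[>] (0 : ℝ), 0 < κ := eventually_mem_nhdsWithin
  -- (3) convergence on the generating set: constants …
  have h1mem : MemLp (fun _ : PhaseSpace L => (1 : ℝ)) 2 (P.gibbsMeasure L T) := memLp_const 1
  have hOne : Tendsto (fun κ => ⟪W κ, h1mem.toLp _⟫_ℝ) (𝓝[>] 0) (𝓝 0) := by
    refine (tendsto_const_nhds (x := (0 : ℝ))).congr' ?_
    filter_upwards [hev] with κ hκ
    rw [hWpos κ hκ, hW κ hκ _ h1mem]
    simp [hmean κ hκ]
  -- … and the adjoint range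
  have hNmem : ∀ (f : PhaseSpace L → ℝ), ContDiff ℝ ∞ f → HasCompactSupport f →
      MemLp (fun x => (-σ) * liouvilleOp P L f x + c * bathOp L B T f x + 0 * f x) 2 (P.gibbsMeasure L T) :=
    fun f hf hfc =>
    memLp_two_of_hasCompactSupport _ (continuous_genOp hU1 hV1 L (-σ) c 0 B T (hf.of_le (by norm_cast)))
      (hasCompactSupport_genOp L (-σ) c 0 B T (hf.of_le (by norm_cast)) hfc)
  have hRange : ∀ (f : PhaseSpace L → ℝ) (hf : ContDiff ℝ ∞ f) (hfc : HasCompactSupport f),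
      Tendsto (fun κ => ⟪W κ, (hNmem f hf hfc).toLp _⟫_ℝ) (𝓝[>] 0) (𝓝 0) := by
    intro f hf hfc
    have hf2 : ContDiff ℝ 2 f := hf.of_le (by norm_cast)
    have hfL2 : MemLp f 2 (P.gibbsMeasure L T) := memLp_two_of_hasCompactSupport _ hf.continuous hfc
    -- for κ > 0: ⟪W κ, [L^† f]⟫ = κ ⟪W κ, [f]⟫ − κ ∫ f k dμ
    have hformula : ∀ᶠ κ in 𝓝[>] (0 : ℝ), ⟪W κ, (hNmem f hf hfc).toLp _⟫_ℝ =
        κ * ⟪W κ, hfL2.toLp f⟫_ℝ - κ * ∫ x, f x * k x ∂(P.gibbsMeasure L T) := by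
      filter_upwards [hev] with κ hκ
      rw [hWpos κ hκ, hW κ hκ _ (hNmem f hf hfc), hW κ hκ _ hfL2]
      have hadj := integral_adjointOp_mul_resolvent hω hl hβ L hT B σ c κ hf2 hfc (hC2 κ hκ) (hL2 κ hκ) hk2
        (hpair κ hκ)
      have e1 : ∫ x, v κ x * ((-σ) * liouvilleOp P L f x + c * bathOp L B T f x + 0 * f x)
          ∂(P.gibbsMeasure L T) =
          ∫ x, (-σ * liouvilleOp P L f x + c * bathOp L B T f x + 0 * f x) * v κ x ∂(P.gibbsMeasure L T) :=
        integral_congr_ae (ae_of_all _ fun x => by ring)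
      have e2 : ∫ x, f x * v κ x ∂(P.gibbsMeasure L T) = ∫ x, v κ x * f x ∂(P.gibbsMeasure L T) :=
        integral_congr_ae (ae_of_all _ fun x => by ring)
      rw [e1, hadj, e2]
      ring
    have hlim1 : Tendsto (fun κ : ℝ => κ * ⟪W κ, hfL2.toLp f⟫_ℝ) (𝓝[>] 0) (𝓝 0) := by
      refine squeeze_zero_norm' (a := fun κ : ℝ => |κ| * (C₀ * ‖hfL2.toLp f‖)) ?_ ?_
      · filter_upwards with κ
        rw [Real.norm_eq_abs, abs_mul]
        refine mul_le_mul_of_nonneg_left ?_ (abs_nonneg κ)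
        exact (abs_real_inner_le_norm _ _).trans (mul_le_mul_of_nonneg_right (hWnorm' κ) (norm_nonneg _))
      · refine tendsto_nhdsWithin_of_tendsto_nhds ?_
        simpa using ((continuous_abs.tendsto (0 : ℝ)).mul_const (C₀ * ‖hfL2.toLp f‖))
    have hlim2 : Tendsto (fun κ : ℝ => κ * ∫ x, f x * k x ∂(P.gibbsMeasure L T)) (𝓝[>] 0) (𝓝 0) := by
      refine tendsto_nhdsWithin_of_tendsto_nhds ?_
      simpa using (tendsto_id (x := 𝓝 (0 : ℝ))).mul_const (∫ x, f x * k x ∂(P.gibbsMeasure L T))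
    simpa using (hlim1.sub hlim2).congr' (hformula.mono fun κ hκ => hκ.symm)
  -- (4) the dense subspace `D = span(1, L^†(C_c^∞))` and convergence on it
  set S : Set (Lp ℝ 2 (P.gibbsMeasure L T)) :=
    insert (h1mem.toLp _) {u | ∃ (f : PhaseSpace L → ℝ) (hf : ContDiff ℝ ∞ f)
      (hfc : HasCompactSupport f), u = (hNmem f hf hfc).toLp _} with hSdef
  have hS : ∀ u ∈ S, Tendsto (fun κ => ⟪W κ, u⟫_ℝ) (𝓝[>] 0) (𝓝 0) := by
    intro u hu
    rcases hu with rfl | ⟨f, hf, hfc, rfl⟩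
    · exact hOne
    · exact hRange f hf hfc
  have hspan : ∀ u ∈ Submodule.span ℝ S, Tendsto (fun κ => ⟪W κ, u⟫_ℝ) (𝓝[>] 0) (𝓝 0) := by
    intro u hu
    refine Submodule.span_induction (p := fun u _ => Tendsto (fun κ => ⟪W κ, u⟫_ℝ) (𝓝[>] 0) (𝓝 0))
      (fun u hu => hS u hu) ?_ ?_ ?_ hu
    · exact (tendsto_const_nhds (x := (0 : ℝ))).congr fun κ => (inner_zero_right (W κ)).symm
    · intro u w _ _ hu hw
      simpa [inner_add_right] using hu.add hw
    · intro a u _ hu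
      simpa [real_inner_smul_right] using hu.const_mul a
  -- density: the orthogonal complement of `span S` is trivial
  have hDorth : (Submodule.span ℝ S)ᗮ = ⊥ := by
    rw [Submodule.eq_bot_iff]
    intro u hu
    have h1 : ⟪h1mem.toLp _, u⟫_ℝ = 0 :=
      Submodule.inner_right_of_mem_orthogonal (Submodule.subset_span (Set.mem_insert _ _)) hu
    have h2 : ∀ (f : PhaseSpace L → ℝ) (hf : ContDiff ℝ ∞ f) (hfc : HasCompactSupport f),
        ⟪(hNmem f hf hfc).toLp _, u⟫_ℝ = 0 := by
      intro f hf hfc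
      have hmemS : (hNmem f hf hfc).toLp _ ∈ S := by
        rw [hSdef]
        exact Set.mem_insert_of_mem _ ⟨f, hf, hfc, rfl⟩
      exact Submodule.inner_right_of_mem_orthogonal (Submodule.subset_span hmemS) hu
    rw [inner_toLp_left] at h1
    simp only [one_mul] at h1
    have horth : ∀ φ' : PhaseSpace L → ℝ, ContDiff ℝ ∞ φ' → HasCompactSupport φ' →
        ∫ x, (-σ * liouvilleOp P L φ' x + c * bathOp L B T φ' x + 0 * φ' x) * u x
          ∂(P.gibbsMeasure L T) = 0 := by
      intro φ' hφ' hφ'c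
      have e := h2 φ' hφ' hφ'c
      rw [inner_toLp_left] at e
      exact e
    have hae := ae_eq_zero_of_orthogonal_adjointRange hω hl hβ γ hL hT hσ hc hB hB0 (Lp.memLp u) h1 horth
    exact Lp.eq_zero_iff_ae_eq_zero.2 hae
  have hdense : (Submodule.span ℝ S).topologicalClosure = ⊤ :=
    Submodule.topologicalClosure_eq_top_iff.2 hDorth
  -- (5) ε/2: bounded family + convergence on a dense subspace
  have hΦcl : hφ.toLp φ ∈ closure ((Submodule.span ℝ S : Submodule ℝ (Lp ℝ 2 (P.gibbsMeasure L T))) :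
      Set (Lp ℝ 2 (P.gibbsMeasure L T))) := by
    rw [← Submodule.topologicalClosure_coe, hdense]
    trivial
  have hmain : Tendsto (fun κ => ⟪W κ, hφ.toLp φ⟫_ℝ) (𝓝[>] 0) (𝓝 0) := by
    rw [Metric.tendsto_nhds]
    intro ε hε
    have hδ : 0 < ε / (2 * (C₀ + 1)) := by positivity
    obtain ⟨ψ, hψS, hψd⟩ := Metric.mem_closure_iff.1 hΦcl _ hδ
    have hψlim := Metric.tendsto_nhds.1 (hspan ψ hψS) (ε / 2) (by positivity)
    filter_upwards [hψlim] with κ hκ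
    rw [Real.dist_0_eq_abs] at hκ ⊢
    have hsplit : ⟪W κ, hφ.toLp φ⟫_ℝ = ⟪W κ, ψ⟫_ℝ + ⟪W κ, hφ.toLp φ - ψ⟫_ℝ := by
      rw [inner_sub_right]; ring
    rw [hsplit]
    have hb : |⟪W κ, hφ.toLp φ - ψ⟫_ℝ| ≤ C₀ * (ε / (2 * (C₀ + 1))) := by
      refine (abs_real_inner_le_norm _ _).trans ?_
      refine mul_le_mul (hWnorm' κ) ?_ (norm_nonneg _) hC₀nn
      rw [← dist_eq_norm]
      exact hψd.le
    have hc' : C₀ * (ε / (2 * (C₀ + 1))) < ε / 2 := by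
      rw [show C₀ * (ε / (2 * (C₀ + 1))) = (ε / 2) * (C₀ / (C₀ + 1)) by field_simp]
      have : C₀ / (C₀ + 1) < 1 := by
        rw [div_lt_one (by positivity)]; linarith
      nlinarith
    calc |⟪W κ, ψ⟫_ℝ + ⟪W κ, hφ.toLp φ - ψ⟫_ℝ|
        ≤ |⟪W κ, ψ⟫_ℝ| + |⟪W κ, hφ.toLp φ - ψ⟫_ℝ| := abs_add_le _ _
      _ < ε / 2 + ε / 2 := add_lt_add_of_lt_of_le hκ (hb.trans hc'.le)
      _ = ε := by ring
  -- back to the statement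
  refine hmain.congr' ?_
  filter_upwards [hev] with κ hκ
  rw [hWpos κ hκ, hW κ hκ φ hφ]

end General

/-! ## The registered special case: the backward operator of the plain chain -/

/-- **MEAN-ERGODIC LEMMA AT THE END PLACEMENT (helper toward ENDλ `stub_kuboLink_resolvent`).**  For
`pinnedChain ω₂ lam β γ` (`ω₂ > 0`, `lam, β ≥ 0`, `γ > 0`), `T > 0`, `L ≥ 1` and ANY family `v_l ∈ C² ∩ L²(μ_T)`
(`l > 0`) of classical solutions of the BACKWARD resolvent equation of the plain chain
`l v_l − (−X_H v_l + γ (S_0 v_l + S_{L−1} v_l)) = p_0² − T`:  `l ∫ v_l φ dμ_T → 0` as `l → 0⁺` for every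
`φ ∈ L²(μ_T)` (`tendsto_resolvent_pairing` with `σ = −1`, `c = γ`, `B = bathWeight L`; the source `p_0² − T` has
mean zero by equipartition `pinnedChain_integral_snd_sq`). [folklore] -/
theorem relocEnd_meanErgodic :
    ∀ (ω₂ lam β γ T : ℝ), 0 < ω₂ → 0 ≤ lam → 0 ≤ β → 0 < γ → 0 < T → ∀ (L : ℕ), 0 < L →
      ∀ (v : ℝ → PhaseSpace L → ℝ),
        (∀ l : ℝ, 0 < l → ContDiff ℝ 2 (v l) ∧ MemLp (v l) 2 ((pinnedChain ω₂ lam β γ).gibbsMeasure L T) ∧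
          ∀ x, l * v l x - (-liouvilleOp (pinnedChain ω₂ lam β γ) L (v l) x +
            γ * (thermo L 0 T (v l) x + thermo L (L - 1) T (v l) x)) = kin L 0 x - T) →
      ∀ (φ : PhaseSpace L → ℝ), MemLp φ 2 ((pinnedChain ω₂ lam β γ).gibbsMeasure L T) →
        Tendsto (fun l : ℝ => l * ∫ x, v l x * φ x ∂((pinnedChain ω₂ lam β γ).gibbsMeasure L T))
          (𝓝[>] 0) (𝓝 0) := by
  intro ω₂ lam β γ T hω hl hβ hγ hT L hL0 v hv φ hφ
  set P := pinnedChain ω₂ lam β γ with hP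
  haveI : IsProbabilityMeasure (P.gibbsMeasure L T) :=
    pinnedChain_isProbabilityMeasure_gibbsMeasure hω hl hβ γ L hT
  set B : Fin L → ℝ := OscillatorChain.bathWeight L with hBdef
  have hB : ∀ i, 0 ≤ B i := fun i => by
    simp only [hBdef, OscillatorChain.bathWeight]
    split_ifs <;> norm_num
  have hB0 : 0 < B ⟨0, hL0⟩ := by
    simp only [hBdef, OscillatorChain.bathWeight, if_true]
    split_ifs <;> norm_num
  have hk2 : MemLp (fun x : PhaseSpace L => kin L 0 x - T) 2 (P.gibbsMeasure L T) :=
    (pinnedChain_memLp_two_kin hω hl hβ γ L 0 hT).sub (memLp_const T)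
  -- the family in weighted form
  have hv' : ∀ l : ℝ, 0 < l → ContDiff ℝ 2 (v l) ∧ MemLp (v l) 2 (P.gibbsMeasure L T) ∧
      ∀ x, l * v l x - ((-1) * liouvilleOp P L (v l) x + γ * bathOp L B T (v l) x) = kin L 0 x - T := by
    intro l hlpos
    obtain ⟨h1, h2, h3⟩ := hv l hlpos
    refine ⟨h1, h2, fun x => ?_⟩
    rw [hBdef, bathOp_bathWeight_eq_thermo, neg_one_mul]
    exact h3 x
  -- the source has mean zero (equipartition `⟨p_0²⟩ = T`)
  have hk0 : ∫ x, (kin L 0 x - T) ∂(P.gibbsMeasure L T) = 0 := by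
    have i1 : Integrable (fun x : PhaseSpace L => x.2 ⟨0, hL0⟩ ^ 2) (P.gibbsMeasure L T) :=
      (pinnedChain_memLp_two_snd hω hl hβ γ L hT ⟨0, hL0⟩).integrable_sq
    have e1 : ∫ x, (kin L 0 x - T) ∂(P.gibbsMeasure L T) =
        ∫ x, (x.2 ⟨0, hL0⟩ ^ 2 - T) ∂(P.gibbsMeasure L T) :=
      integral_congr_ae (ae_of_all _ fun x => by dsimp only; rw [kin_eq_sq hL0])
    rw [e1, integral_sub i1 (integrable_const T), pinnedChain_integral_snd_sq hω hl hβ γ L hT ⟨0, hL0⟩,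
      integral_const]
    simp
  exact tendsto_resolvent_pairing hω hl hβ γ hL0 hT (neg_ne_zero.2 one_ne_zero) hγ hB hB0 hk2 hk0 hv' hφ

end Summit.AtomisticToContinuum.FouriersLaw.Cruxes.ConductanceLowerBound.ColdBathRelocationWalk

end
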